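import Mathlib
import HarnessLib
import Summits.ValiantsHypothesis.ValiantsHypothesis.Theses.MonotoneRestoration
import Literature.Computability.AlgebraicComplexity.ArithCircuit
import Literature.Computability.AlgebraicComplexity.ArithCircuitProofs
import Literature.Computability.AlgebraicComplexity.MonotoneStructure
import Literature.Computability.AlgebraicComplexity.PermanentIrreducible
import Literature.ModelTheory.FiniteModelTheory.CkEquiv
import Summits.ValiantsHypothesis.ValiantsHypothesis.Theorems.MonotoneRestorationMonotoneRestorationQPCosetCount
import Summits.ValiantsHypothesis.ValiantsHypothesis.Theorems.MonotoneRestorationMonotoneRestorationQPSymmetricLB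
import Summits.ValiantsHypothesis.ValiantsHypothesis.Theorems.MonotoneRestorationMonotoneRestorationQPSupportSymmetrisation
import Summits.ValiantsHypothesis.ValiantsHypothesis.Theorems.MonotoneRestorationMonotoneRestorationQPSparseRegime
import Summits.ValiantsHypothesis.ValiantsHypothesis.Theorems.MonotoneRestorationMonotoneRestorationQPBeta
import Literature.Computability.AlgebraicComplexity.SymmetricArithCircuit
import Literature.Computability.AlgebraicComplexity.DawarWilsenach2025Proofs
import Literature.GroupTheory.PermutationGroups.SmallIndexSubgroups
import Summits.ValiantsHypothesis.ValiantsHypothesis.Theorems.MonotoneRestorationQP.Negative.LoadBearing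
import Summits.ValiantsHypothesis.ValiantsHypothesis.Theorems.MonotoneRestorationMonotoneRestorationQPPermSupportCount

/-! TTRL-lite variant V19908 of stmt-ValiantsHypothesis-15886 -/

-- `ValiantsHypothesis.ValiantsHypothesis`: the D-0017 layout repeats the problem name in the path.
set_option linter.dupNamespace false

namespace Summit.ValiantsHypothesis.ValiantsHypothesis.Theorems

open Summit.ValiantsHypothesis.ValiantsHypothesis.Theses.MonotoneRestoration
open Literature.Computability.AlgebraicComplexity

/-- **Row shadows of two factors of a row-multilinear monomial are disjoint** (TTRL-lite variant
V19908 of `stub_mulGate_children_extend`; the polynomial-level form of conjunct (2) used in the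
multiplication-gate step). If every monomial of `f` has degree at most one in each row and
`m + m' + μ` is a monomial of `f`, then no row meets both `m` and `m'`: row degrees are additive
(`rowDegrees_add`), so `rowDegrees m i + rowDegrees m' i + rowDegrees μ i ≤ 1` for every row `i`,
and two positive summands are impossible. [folklore] -/
theorem stub_mulGate_children_extend_var19908 :
    ∀ (n : ℕ) (f : MvPolynomial (Fin n × Fin n) NNReal) (m m' μ : (Fin n × Fin n) →₀ ℕ),
      (∀ M ∈ f.support, ∀ i : Fin n, rowDegrees M i ≤ 1) → m + m' + μ ∈ f.support →
      Disjoint (rowDegrees m).support (rowDegrees m').support := by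
  intro n f m m' μ hrow hmem
  rw [Finset.disjoint_left]
  intro i hi hi'
  have h := hrow _ hmem i
  rw [rowDegrees_add, rowDegrees_add, Finsupp.add_apply, Finsupp.add_apply] at h
  rw [Finsupp.mem_support_iff] at hi hi'
  omega

end Summit.ValiantsHypothesis.ValiantsHypothesis.Theorems
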